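import Summits.CriticalPhenomena.PercolationContinuityZ3.Theorems.PercExchangeRateTransportCriticalCurveRegular
import Summits.CriticalPhenomena.PercolationContinuityZ3.Theorems.PercExchangeRateTransportModelFacts
import Summits.CriticalPhenomena.PercolationContinuityZ3.Theorems.SubcritExchangeUniformity.Negative.Objects

/-!
# Forward generator G1 `next-rung`, generation 8 — seed `CriticalCurveRegular` (stmt-CriticalPhenomena-16065)

Coverage certificate of planner-fwd2-rung-CriticalPhenomena-01-g8-0 (no filing).  The one class of
on-path candidate rungs over the floor `CriticalCurveRegular` (continuity of the anisotropic critical curve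
`t ↦ p_c(t)` of bond percolation on `ℤ²×ℤ`, `0 < p_c < 1`) not charted by generations 1–7 is the class of
TRANSVERSAL VALUE COMPARISONS AT THE ISOTROPIC CORNER `(p₃,p₃)`, `p₃ := p_c(ℤ³)`:

* `IsoCornerDomination c`   (down-right, slope `c`):  `θ(p₃,p₃) ≤ θ(p₃ + c h, p₃ − h)` for all small `h > 0`;
* `IsoCornerCoDomination c` (up-left,   slope `c`):   `θ(p₃,p₃) ≤ θ(p₃ − c h, p₃ + h)` for all small `h > 0`

(each as the `T = {p₃}` member of a family `…Within c T := floor ∧ ∀ t₀ ∈ T ∩ (0,1), …` whose `T = ∅`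
member is the floor).  Both are ON THE S-PATH for every `c` (`PercolationContinuityZ3` gives
`θ(p₃,p₃) = θ_{ℤ³}(p_c) = 0 ≤ θ`), and this file proves that the whole class is already charted:

* `isoCornerDomination_of_floorShear` — for `c ≥ C_floor` (the constant of the seed's Aizenman–Grimmett
  shear `Locmod.theta_shear`) the rung is PROVED from the tree: FLAT;
* `isoCornerDomination_of_isoUpperShear` — for every `c > 1/2` the rung is the `(p,t) = (p₃,p₃)`,
  `η = c − 1/2` instance of generation 2's REGISTERED stub `IsoTangent.stub_isoUpperShear`
  (`Cruxes/SupercritExchangeUniformity/Lines/isotropic_tangency.lean`): COVERED (a corollary of a registered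
  stub is not a new line);
* `percolationContinuityZ3_of_isoCornerDomination_neg` — for `c < 0` the rung implies `S`: SUMMIT-STRENGTH
  (and for `0 < c < 1/2` it implies `S` given any left-slope bound `σ⁻(p₃) > c`, e.g. given generation 2's
  rung `IsotropicTangency`; `c = 0` is "corner value ≤ shelf values", `S` given generation 5's `IsoShelfNull`);
* `isoCornerCoDomination_of_isoLowerShear` — for `0 < c < 1/2` the up-left rung is the corner instance of
  generation 2's REGISTERED stub `IsoTangent.stub_isoLowerShear` (and, for the small constant `c_AG`, of
  generation 5's registered stubs `IsoShelf.stub_reverseComparabilityAtIso` + `stub_slantIntegration`):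
  COVERED; `c ≤ 0` is trivial by monotonicity (`isoCornerCoDomination_of_nonpos`);
* `percolationContinuityZ3_of_isoCornerCoDomination_large` — for `c > C_floor` the up-left rung implies `S`
  (floor shear back to the sub-isotropic quadrant): SUMMIT-STRENGTH.

Hence no member of the class is a new, real-step, non-summit rung with a lever of its own: the open
members (`1/2 < c < C_floor` down-right, `c_AG < c < 1/2` up-left) are exactly "the Aizenman–Grimmett
exchange inequality near isotropy with an honest constant", i.e. parameter specialisations of generation 2's
stubs (and, at `c → 1/2`, the K± germs themselves).  Everything here is sorry-free.
-/

namespace Summit.CriticalPhenomena.PercolationContinuityZ3.Cruxes.SupercritExchangeUniformity.FwdRungG8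

open Summit.CriticalPhenomena.PercolationContinuityZ3.Theses.PercExchangeRateTransport
open Summit.CriticalPhenomena.PercolationContinuityZ3.Theorems.SubcritExchangeUniformity.Negative
  (thetaPerc pcurve)

/-- `p₃ = p_c(ℤ³)` (input notation only). -/
local notation "𝔭₃" => Literature.Probability.Percolation.criticalProb
  (Literature.Probability.LatticeModels.zdGraph 3) (0 : Literature.Probability.LatticeModels.Site 3)

/-! ### The two families and the candidate rungs -/

/-- FAMILY (down-right transversal domination with slope `c`, at the diagonal points `t₀ ∈ T ∩ (0,1)`):
the floor `CriticalCurveRegular` AND `θ(t₀,t₀) ≤ θ(t₀ + c h, t₀ − h)` for all small `h > 0`.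
`T = ∅` is the floor (`cornerDominationWithin_empty_iff`). -/
def CornerDominationWithin (c : ℝ) (T : Set ℝ) : Prop :=
  CriticalCurveRegular ∧ ∀ t₀ ∈ T, t₀ ∈ Set.Ioo (0 : ℝ) 1 →
    ∃ h₀ : ℝ, 0 < h₀ ∧ ∀ h ∈ Set.Ioo (0 : ℝ) h₀, thetaPerc t₀ t₀ ≤ thetaPerc (t₀ + c * h) (t₀ - h)

/-- CANDIDATE RUNG `R(c)`: down-right domination at the isotropic corner, `T = {p_c(ℤ³)}`. -/
def IsoCornerDomination (c : ℝ) : Prop := CornerDominationWithin c {𝔭₃}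

/-- The `c = 1` member ("one-for-one exchange at the isotropic critical point does not lower `θ`"),
the candidate examined by the tribunal kernel. -/
def IsoUnitExchangeDomination : Prop := IsoCornerDomination 1

/-- FAMILY (up-left transversal domination with slope `c`). -/
def CornerCoDominationWithin (c : ℝ) (T : Set ℝ) : Prop :=
  CriticalCurveRegular ∧ ∀ t₀ ∈ T, t₀ ∈ Set.Ioo (0 : ℝ) 1 →
    ∃ h₀ : ℝ, 0 < h₀ ∧ ∀ h ∈ Set.Ioo (0 : ℝ) h₀, thetaPerc t₀ t₀ ≤ thetaPerc (t₀ - c * h) (t₀ + h)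

/-- CANDIDATE RUNG `L(c)`: up-left domination at the isotropic corner. -/
def IsoCornerCoDomination (c : ℝ) : Prop := CornerCoDominationWithin c {𝔭₃}

/-! ### Elementary facts about the route's objects -/

theorem p3_mem_Ioo : (0 : ℝ) < 𝔭₃ ∧ 𝔭₃ < 1 :=
  Literature.Probability.Percolation.Grimmett1999_criticalProb_pos_lt_one_holds 3 (by norm_num)

/-- `θ(p,t)` is nondecreasing in both parameters (the seed's pathwise coupling). -/
theorem thetaPerc_mono {p p' t t' : ℝ} (hp : p ≤ p') (ht : t ≤ t') : thetaPerc p t ≤ thetaPerc p' t' :=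
  Summit.CriticalPhenomena.PercolationContinuityZ3.Cruxes.CriticalCurveRegular.Locmod.theta_mono hp ht

theorem thetaPerc_nonneg (p t : ℝ) : 0 ≤ thetaPerc p t := MeasureTheory.measureReal_nonneg

/-- Diagonal = `ℤ³`: `θ(q,q) = θ_{ℤ³}(q)` for `q ∈ [0,1]` (`ModelFacts` clause (9)). -/
theorem thetaPerc_diag (q : unitInterval) :
    thetaPerc q q = Literature.Probability.Percolation.theta (Literature.Probability.LatticeModels.zdGraph 3) 0 q := by
  obtain ⟨-, -, -, -, -, -, -, -, h9, -⟩ :=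
    Summit.CriticalPhenomena.PercolationContinuityZ3.Theorems.ModelFacts.modelFacts_proof
  exact h9 q

/-- Diagonal phase structure below the isotropic point: `θ(q,q) = 0` for `0 ≤ q < p_c(ℤ³)`. -/
theorem thetaPerc_diag_eq_zero {q : ℝ} (hq0 : 0 ≤ q) (hq : q < 𝔭₃) : thetaPerc q q = 0 := by
  have hq1 : q ≤ 1 := (hq.trans p3_mem_Ioo.2).le
  have e := thetaPerc_diag ⟨q, hq0, hq1⟩
  exact e.trans (Literature.Probability.Percolation.theta_eq_zero_of_lt_criticalProb_holds _ _ ⟨q, hq0, hq1⟩ hq)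

/-- Under `S`, the corner value vanishes: `θ(p₃,p₃) = θ_{ℤ³}(p_c) = 0`. -/
theorem thetaPerc_corner_eq_zero_of_S (hS : _root_.PercolationContinuityZ3) : thetaPerc 𝔭₃ 𝔭₃ = 0 :=
  (thetaPerc_diag (Literature.Probability.Percolation.criticalProbI 3)).trans hS

/-- Conversely `θ(p₃,p₃) = 0` is `S`. -/
theorem S_of_thetaPerc_corner_eq_zero (h : thetaPerc 𝔭₃ 𝔭₃ = 0) : _root_.PercolationContinuityZ3 :=
  (thetaPerc_diag (Literature.Probability.Percolation.criticalProbI 3)).symm.trans h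

/-! ### Family bookkeeping (F3: the floor is the `T = ∅` member) -/

theorem cornerDominationWithin_anti {c : ℝ} {T T' : Set ℝ} (h : T ⊆ T') :
    CornerDominationWithin c T' → CornerDominationWithin c T := fun h' => ⟨h'.1, fun t ht => h'.2 t (h ht)⟩

theorem cornerDominationWithin_empty_iff (c : ℝ) : CornerDominationWithin c ∅ ↔ CriticalCurveRegular :=
  ⟨fun h => h.1, fun h => ⟨h, fun t ht => (Set.notMem_empty t ht).elim⟩⟩

theorem cornerDominationWithin_empty (c : ℝ) : CornerDominationWithin c ∅ :=
  (cornerDominationWithin_empty_iff c).2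
    Summit.CriticalPhenomena.PercolationContinuityZ3.Cruxes.CriticalCurveRegular.Locmod.CriticalCurveRegular_proof

/-- F3 witness for the examined member: the floor instance of the `c = 1` family. -/
theorem cornerDominationWithin_one_empty : CornerDominationWithin 1 ∅ := cornerDominationWithin_empty 1

/-- `R(c)` is monotone in `c` (larger slope = larger comparison point). -/
theorem isoCornerDomination_mono {c c' : ℝ} (hcc : c ≤ c') : IsoCornerDomination c → IsoCornerDomination c' := by
  rintro ⟨hF, h⟩
  refine ⟨hF, fun t₀ ht₀ hI => ?_⟩
  obtain ⟨h₀, hh₀, hdom⟩ := h t₀ ht₀ hI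
  refine ⟨h₀, hh₀, fun h hh => (hdom h hh).trans (thetaPerc_mono ?_ le_rfl)⟩
  nlinarith [hh.1]

@[aesop safe forward] theorem criticalCurveRegular_of_isoCornerDomination (c : ℝ) :
    IsoCornerDomination c → CriticalCurveRegular := fun h => h.1

@[aesop safe forward] theorem criticalCurveRegular_of_isoUnitExchangeDomination :
    IsoUnitExchangeDomination → CriticalCurveRegular := fun h => h.1

theorem floor_of_rung (c : ℝ) : IsoCornerDomination c → CornerDominationWithin c ∅ :=
  cornerDominationWithin_anti (Set.empty_subset _)

theorem cornerCoDominationWithin_empty_iff (c : ℝ) : CornerCoDominationWithin c ∅ ↔ CriticalCurveRegular :=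
  ⟨fun h => h.1, fun h => ⟨h, fun t ht => (Set.notMem_empty t ht).elim⟩⟩

@[aesop safe forward] theorem criticalCurveRegular_of_isoCornerCoDomination (c : ℝ) :
    IsoCornerCoDomination c → CriticalCurveRegular := fun h => h.1

/-! ### ON-PATH (F4): `S` implies every member of both classes -/

@[aesop safe forward] theorem isoCornerDomination_of_percolationContinuityZ3 (c : ℝ)
    (hS : _root_.PercolationContinuityZ3) : IsoCornerDomination c := by
  refine ⟨Summit.CriticalPhenomena.PercolationContinuityZ3.Cruxes.CriticalCurveRegular.Locmod.CriticalCurveRegular_proof,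
    fun t₀ ht₀ _ => ⟨1, one_pos, fun h _ => ?_⟩⟩
  rw [Set.mem_singleton_iff] at ht₀
  rw [ht₀, thetaPerc_corner_eq_zero_of_S hS]
  exact thetaPerc_nonneg _ _

@[aesop safe forward, simp] theorem isoUnitExchangeDomination_of_percolationContinuityZ3
    (hS : _root_.PercolationContinuityZ3) : IsoUnitExchangeDomination :=
  isoCornerDomination_of_percolationContinuityZ3 1 hS

@[aesop safe forward] theorem isoCornerCoDomination_of_percolationContinuityZ3 (c : ℝ)
    (hS : _root_.PercolationContinuityZ3) : IsoCornerCoDomination c := by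
  refine ⟨Summit.CriticalPhenomena.PercolationContinuityZ3.Cruxes.CriticalCurveRegular.Locmod.CriticalCurveRegular_proof,
    fun t₀ ht₀ _ => ⟨1, one_pos, fun h _ => ?_⟩⟩
  rw [Set.mem_singleton_iff] at ht₀
  rw [ht₀, thetaPerc_corner_eq_zero_of_S hS]
  exact thetaPerc_nonneg _ _

/-- `S → R(1) → floor`. -/
theorem rung_between :
    (_root_.PercolationContinuityZ3 → IsoUnitExchangeDomination) ∧ (IsoUnitExchangeDomination → CriticalCurveRegular) :=
  ⟨isoUnitExchangeDomination_of_percolationContinuityZ3, criticalCurveRegular_of_isoUnitExchangeDomination⟩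

/-! ### FLAT END: `R(c)` for `c ≥ C_floor` is a theorem of the tree (the seed's own shear at the corner) -/

/-- **Flat.** With `C` the constant of the seed's Aizenman–Grimmett shear `Locmod.theta_shear`
(`C = μ₀^{-N} 2^N N`), `R(c)` holds for every `c ≥ C`: the floor's engine proves the down-right comparison
outright, so only `c < C_floor` can be a rung. -/
theorem isoCornerDomination_of_floorShear : ∃ C : ℝ, 0 ≤ C ∧ ∀ c : ℝ, C ≤ c → IsoCornerDomination c := by
  obtain ⟨N, hN⟩ := Summit.CriticalPhenomena.PercolationContinuityZ3.Cruxes.CriticalCurveRegular.Locmod.theta_shear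
  obtain ⟨h3l, h3u⟩ := p3_mem_Ioo
  obtain ⟨μ₀, hμ₀, hμ₁, hμp, hμq⟩ : ∃ μ₀ : ℝ, 0 < μ₀ ∧ μ₀ ≤ 1 / 2 ∧ μ₀ ≤ 𝔭₃ / 2 ∧ μ₀ ≤ (1 - 𝔭₃) / 2 :=
    ⟨min (1 / 2) (min (𝔭₃ / 2) ((1 - 𝔭₃) / 2)),
      lt_min (by norm_num) (lt_min (by linarith) (by linarith)), min_le_left _ _,
      (min_le_right _ _).trans (min_le_left _ _), (min_le_right _ _).trans (min_le_right _ _)⟩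
  have hC0 : 0 ≤ (μ₀ ^ N)⁻¹ * 2 ^ N * (N : ℝ) :=
    mul_nonneg (mul_nonneg (inv_nonneg.2 (pow_nonneg hμ₀.le _)) (by positivity)) (Nat.cast_nonneg _)
  refine ⟨(μ₀ ^ N)⁻¹ * 2 ^ N * (N : ℝ), hC0, fun c hc => ?_⟩
  refine isoCornerDomination_mono hc ?_
  refine ⟨Summit.CriticalPhenomena.PercolationContinuityZ3.Cruxes.CriticalCurveRegular.Locmod.CriticalCurveRegular_proof,
    fun t₀ ht₀ _ => ?_⟩
  rw [Set.mem_singleton_iff] at ht₀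
  subst ht₀
  -- step bound: h ≤ p₃/2 and C h ≤ (1 - p₃)/2
  refine ⟨min (𝔭₃ / 2) ((1 - 𝔭₃) / (2 * ((μ₀ ^ N)⁻¹ * 2 ^ N * (N : ℝ) + 1))), lt_min (by linarith) (by positivity),
    fun h hh => ?_⟩
  obtain ⟨hh0, hh1⟩ := hh
  have hhp : h ≤ 𝔭₃ / 2 := hh1.le.trans (min_le_left _ _)
  have hhq : h ≤ (1 - 𝔭₃) / (2 * ((μ₀ ^ N)⁻¹ * 2 ^ N * (N : ℝ) + 1)) := hh1.le.trans (min_le_right _ _)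
  have hCh : (μ₀ ^ N)⁻¹ * 2 ^ N * (N : ℝ) * h ≤ (1 - 𝔭₃) / 2 := by
    have h1 : (μ₀ ^ N)⁻¹ * 2 ^ N * (N : ℝ) * h ≤ ((μ₀ ^ N)⁻¹ * 2 ^ N * (N : ℝ) + 1) * h :=
      mul_le_mul_of_nonneg_right (by linarith) hh0.le
    have h2 : ((μ₀ ^ N)⁻¹ * 2 ^ N * (N : ℝ) + 1) * h ≤
        ((μ₀ ^ N)⁻¹ * 2 ^ N * (N : ℝ) + 1) * ((1 - 𝔭₃) / (2 * ((μ₀ ^ N)⁻¹ * 2 ^ N * (N : ℝ) + 1))) :=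
      mul_le_mul_of_nonneg_left hhq (by linarith)
    have h3 : ((μ₀ ^ N)⁻¹ * 2 ^ N * (N : ℝ) + 1) * ((1 - 𝔭₃) / (2 * ((μ₀ ^ N)⁻¹ * 2 ^ N * (N : ℝ) + 1))) =
        (1 - 𝔭₃) / 2 := by
      field_simp
    linarith
  have key : thetaPerc 𝔭₃ 𝔭₃ ≤ thetaPerc (𝔭₃ + (μ₀ ^ N)⁻¹ * 2 ^ N * (N : ℝ) * h) (𝔭₃ - h) :=
    hN μ₀ hμ₀ hμ₁ 𝔭₃ 𝔭₃ h hh0.le (by linarith) (by linarith) (by linarith) (by linarith)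
  exact key

/-! ### COVERED: `R(c)`, `c > 1/2`, is the corner instance of generation 2's registered stub 1 -/

/-- **Covered by `IsoTangent.stub_isoUpperShear`** (generation 2, registered on stmt-CriticalPhenomena-16061;
its statement is the hypothesis `hUS`, verbatim up to the name `thetaPerc`): `η := c − 1/2`,
`(p,t) := (p₃,p₃)`. -/
theorem isoCornerDomination_of_isoUpperShear
    (hUS : ∀ η : ℝ, 0 < η → ∃ δ : ℝ, 0 < δ ∧ ∀ p t h : ℝ, |p - 𝔭₃| ≤ δ → |t - 𝔭₃| ≤ δ → 0 ≤ h → h ≤ δ →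
      thetaPerc p t ≤ thetaPerc (p + (1 / 2 + η) * h) (t - h))
    {c : ℝ} (hc : 1 / 2 < c) : IsoCornerDomination c := by
  refine ⟨Summit.CriticalPhenomena.PercolationContinuityZ3.Cruxes.CriticalCurveRegular.Locmod.CriticalCurveRegular_proof,
    fun t₀ ht₀ _ => ?_⟩
  rw [Set.mem_singleton_iff] at ht₀
  subst ht₀
  obtain ⟨δ, hδ, hδ'⟩ := hUS (c - 1 / 2) (by linarith)
  refine ⟨δ, hδ, fun h hh => ?_⟩
  have h0 : |𝔭₃ - 𝔭₃| ≤ δ := by rw [sub_self, abs_zero]; exact hδ.le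
  have key := hδ' 𝔭₃ 𝔭₃ h h0 h0 hh.1.le hh.2.le
  have e : (1 / 2 + (c - 1 / 2)) * h = c * h := by ring
  rw [e] at key
  exact key

/-! ### SUMMIT-STRENGTH END: `R(c)` for `c < 0` implies `S` -/

/-- **Summit-strength for negative slopes.** If `c < 0`, the comparison point `(p₃ + c h, p₃ − h)` lies in
the open sub-isotropic quadrant, where `θ ≤ θ(q,q) = θ_{ℤ³}(q) = 0` (`q := max (p₃ + c h) (p₃ − h) < p₃`);
so `R(c)` forces `θ(p₃,p₃) = 0`, i.e. `PercolationContinuityZ3`. -/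
theorem percolationContinuityZ3_of_isoCornerDomination_neg {c : ℝ} (hc : c < 0) :
    IsoCornerDomination c → _root_.PercolationContinuityZ3 := by
  rintro ⟨-, h⟩
  obtain ⟨h3l, h3u⟩ := p3_mem_Ioo
  obtain ⟨h₀, hh₀, hdom⟩ := h 𝔭₃ (Set.mem_singleton _) ⟨h3l, h3u⟩
  -- a step `s` with `0 < s < h₀`, `s ≤ p₃/2` and `|c| s ≤ p₃/2`
  obtain ⟨s, hs0, hs1, hsp, hsc⟩ : ∃ s : ℝ, 0 < s ∧ s < h₀ ∧ s ≤ 𝔭₃ / 2 ∧ -c * s ≤ 𝔭₃ / 2 := by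
    refine ⟨min (h₀ / 2) (min (𝔭₃ / 2) (𝔭₃ / (2 * -c))), lt_min (by linarith) (lt_min (by linarith) ?_),
      (min_le_left _ _).trans_lt (by linarith), (min_le_right _ _).trans (min_le_left _ _), ?_⟩
    · exact div_pos (by linarith) (by nlinarith)
    · have hneg : 0 < -c := by linarith
      calc -c * min (h₀ / 2) (min (𝔭₃ / 2) (𝔭₃ / (2 * -c))) ≤ -c * (𝔭₃ / (2 * -c)) :=
            mul_le_mul_of_nonneg_left ((min_le_right _ _).trans (min_le_right _ _)) hneg.le
        _ = 𝔭₃ / 2 := by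
            have hc0 : c ≠ 0 := hc.ne
            field_simp
  have key := hdom s ⟨hs0, hs1⟩
  have hq3 : max (𝔭₃ + c * s) (𝔭₃ - s) < 𝔭₃ := max_lt (by nlinarith) (by linarith)
  have hq0 : 0 ≤ max (𝔭₃ + c * s) (𝔭₃ - s) := le_trans (by linarith) (le_max_right _ _)
  have hzero : thetaPerc (max (𝔭₃ + c * s) (𝔭₃ - s)) (max (𝔭₃ + c * s) (𝔭₃ - s)) = 0 :=
    thetaPerc_diag_eq_zero hq0 hq3
  have hle : thetaPerc 𝔭₃ 𝔭₃ ≤ 0 :=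
    key.trans ((thetaPerc_mono (le_max_left _ _) (le_max_right _ _)).trans hzero.le)
  exact S_of_thetaPerc_corner_eq_zero (le_antisymm hle (thetaPerc_nonneg _ _))

/-! ### The up-left class -/

/-- `L(c)` for `c ≤ 0` is trivial (the comparison point dominates the corner coordinatewise). -/
theorem isoCornerCoDomination_of_nonpos {c : ℝ} (hc : c ≤ 0) : IsoCornerCoDomination c := by
  refine ⟨Summit.CriticalPhenomena.PercolationContinuityZ3.Cruxes.CriticalCurveRegular.Locmod.CriticalCurveRegular_proof,
    fun t₀ _ _ => ⟨1, one_pos, fun h hh => thetaPerc_mono (by nlinarith [hh.1]) (by linarith [hh.1])⟩⟩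

/-- **Covered by `IsoTangent.stub_isoLowerShear`** (generation 2, registered; statement = `hLS`):
`η := 1/2 − c`, `(p,t) := (p₃,p₃)`, for every `0 < c < 1/2`.  (For the small Aizenman–Grimmett constant
`c_AG` it is equally a corollary of generation 5's registered stubs `IsoShelf.stub_reverseComparabilityAtIso`
+ `stub_slantIntegration` at `(p,t) := (p₃ − c h, p₃)`, through `θ = ⨅ₙ Θₙ`.) -/
theorem isoCornerCoDomination_of_isoLowerShear
    (hLS : ∀ η : ℝ, 0 < η → ∃ δ : ℝ, 0 < δ ∧ ∀ p t h : ℝ, |p - 𝔭₃| ≤ δ → |t - 𝔭₃| ≤ δ → 0 ≤ h → h ≤ δ →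
      thetaPerc p t ≤ thetaPerc (p - (1 / 2 - η) * h) (t + h))
    {c : ℝ} (hc : c < 1 / 2) : IsoCornerCoDomination c := by
  refine ⟨Summit.CriticalPhenomena.PercolationContinuityZ3.Cruxes.CriticalCurveRegular.Locmod.CriticalCurveRegular_proof,
    fun t₀ ht₀ _ => ?_⟩
  rw [Set.mem_singleton_iff] at ht₀
  subst ht₀
  obtain ⟨δ, hδ, hδ'⟩ := hLS (1 / 2 - c) (by linarith)
  refine ⟨δ, hδ, fun h hh => ?_⟩
  have h0 : |𝔭₃ - 𝔭₃| ≤ δ := by rw [sub_self, abs_zero]; exact hδ.le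
  have key := hδ' 𝔭₃ 𝔭₃ h h0 h0 hh.1.le hh.2.le
  have e : (1 / 2 - (1 / 2 - c)) * h = c * h := by ring
  rw [e] at key
  exact key

/-- **Summit-strength for large up-left slopes.** With `C = C_floor`, if `c > C` then `L(c)` implies `S`:
the seed's shear with step `h + h'` carries `(p₃ − c h, p₃ + h)` to `(p₃ − c h + C (h + h'), p₃ − h')`, which
for `0 < C h' < (c − C) h` lies in the open sub-isotropic quadrant where `θ = 0`. -/
theorem percolationContinuityZ3_of_isoCornerCoDomination_large :
    ∃ C : ℝ, 0 ≤ C ∧ ∀ c : ℝ, C < c → IsoCornerCoDomination c → _root_.PercolationContinuityZ3 := by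
  obtain ⟨N, hN⟩ := Summit.CriticalPhenomena.PercolationContinuityZ3.Cruxes.CriticalCurveRegular.Locmod.theta_shear
  obtain ⟨h3l, h3u⟩ := p3_mem_Ioo
  obtain ⟨μ₀, hμ₀, hμ₁, hμp, hμq⟩ : ∃ μ₀ : ℝ, 0 < μ₀ ∧ μ₀ ≤ 1 / 2 ∧ μ₀ ≤ 𝔭₃ / 2 ∧ μ₀ ≤ (1 - 𝔭₃) / 2 :=
    ⟨min (1 / 2) (min (𝔭₃ / 2) ((1 - 𝔭₃) / 2)),
      lt_min (by norm_num) (lt_min (by linarith) (by linarith)), min_le_left _ _,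
      (min_le_right _ _).trans (min_le_left _ _), (min_le_right _ _).trans (min_le_right _ _)⟩
  set C : ℝ := (μ₀ ^ N)⁻¹ * 2 ^ N * (N : ℝ) with hCdef
  have hC0 : 0 ≤ C :=
    mul_nonneg (mul_nonneg (inv_nonneg.2 (pow_nonneg hμ₀.le _)) (by positivity)) (Nat.cast_nonneg _)
  refine ⟨C, hC0, fun c hc hL => ?_⟩
  obtain ⟨-, h⟩ := hL
  obtain ⟨h₀, hh₀, hdom⟩ := h 𝔭₃ (Set.mem_singleton _) ⟨h3l, h3u⟩
  have hcpos : 0 < c := lt_of_le_of_lt hC0 hc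
  -- step `s`: `0 < s < h₀`, `s ≤ p₃/2`, `c s ≤ p₃/2`
  obtain ⟨s, hs0, hs1, hsp, hsq, hsc⟩ :
      ∃ s : ℝ, 0 < s ∧ s < h₀ ∧ s ≤ 𝔭₃ / 2 ∧ s ≤ (1 - 𝔭₃) / 2 ∧ c * s ≤ 𝔭₃ / 2 := by
    have hm : 0 < min (𝔭₃ / 2) ((1 - 𝔭₃) / 2) := lt_min (by linarith) (by linarith)
    refine ⟨min (h₀ / 2) (min (min (𝔭₃ / 2) ((1 - 𝔭₃) / 2)) (𝔭₃ / (2 * c))),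
      lt_min (by linarith) (lt_min hm (by positivity)),
      (min_le_left _ _).trans_lt (by linarith),
      ((min_le_right _ _).trans (min_le_left _ _)).trans (min_le_left _ _),
      ((min_le_right _ _).trans (min_le_left _ _)).trans (min_le_right _ _), ?_⟩
    calc c * min (h₀ / 2) (min (min (𝔭₃ / 2) ((1 - 𝔭₃) / 2)) (𝔭₃ / (2 * c))) ≤ c * (𝔭₃ / (2 * c)) :=
          mul_le_mul_of_nonneg_left ((min_le_right _ _).trans (min_le_right _ _)) hcpos.le
      _ = 𝔭₃ / 2 := by field_simp
  have key := hdom s ⟨hs0, hs1⟩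
  -- second step `s'`: `0 < s'`, `C s' < (c - C) s`, `s' ≤ p₃ / 2`
  obtain ⟨s', hs'0, hs'1, hs'p⟩ : ∃ s' : ℝ, 0 < s' ∧ C * s' < (c - C) * s ∧ s' ≤ 𝔭₃ / 2 := by
    have hgap : 0 < (c - C) * s := mul_pos (by linarith) hs0
    refine ⟨min (𝔭₃ / 2) ((c - C) * s / (2 * (C + 1))), lt_min (by linarith) (by positivity), ?_, min_le_left _ _⟩
    have h1 : C * min (𝔭₃ / 2) ((c - C) * s / (2 * (C + 1))) ≤ C * ((c - C) * s / (2 * (C + 1))) :=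
      mul_le_mul_of_nonneg_left (min_le_right _ _) hC0
    have h2 : C * ((c - C) * s / (2 * (C + 1))) < (c - C) * s := by
      rw [mul_div_assoc']
      rw [div_lt_iff₀ (by positivity)]
      nlinarith
    exact lt_of_le_of_lt h1 h2
  -- the seed's shear at `(p, t) := (p₃ - c s, p₃ + s)` with step `s + s'`
  have hshear : thetaPerc (𝔭₃ - c * s) (𝔭₃ + s) ≤ thetaPerc (𝔭₃ - c * s + C * (s + s')) (𝔭₃ + s - (s + s')) := by
    have := hN μ₀ hμ₀ hμ₁ (𝔭₃ - c * s) (𝔭₃ + s) (s + s') (by linarith) (by linarith)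
      (by nlinarith) (by linarith) (by linarith)
    exact this
  -- the landing point is in the open sub-isotropic quadrant
  have hp' : 𝔭₃ - c * s + C * (s + s') < 𝔭₃ := by nlinarith
  have ht' : 𝔭₃ + s - (s + s') < 𝔭₃ := by linarith
  set q := max (𝔭₃ - c * s + C * (s + s')) (𝔭₃ + s - (s + s')) with hq
  have hq3 : q < 𝔭₃ := max_lt hp' ht'
  have hq0 : 0 ≤ q := le_trans (by linarith) (le_max_right _ _)
  have hzero : thetaPerc q q = 0 := thetaPerc_diag_eq_zero hq0 hq3
  have hle : thetaPerc 𝔭₃ 𝔭₃ ≤ 0 :=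
    key.trans (hshear.trans ((thetaPerc_mono (le_max_left _ _) (le_max_right _ _)).trans hzero.le))
  exact S_of_thetaPerc_corner_eq_zero (le_antisymm hle (thetaPerc_nonneg _ _))

/-! ### Summary of the chart (all arrows kernel-checked above or by the named registered stubs)

* down-right `R(c)`: `c < 0` ⟹ `S` · `0 ≤ c ≤ 1/2`: `S` modulo filed rungs (gen 5 `IsoShelfNull`,
  gen 2 `IsotropicTangency`) · `1/2 < c < C_floor`: instance of gen-2 `stub_isoUpperShear` ·
  `c ≥ C_floor`: FLAT (tree).
* up-left `L(c)`: `c ≤ 0`: trivial · `0 < c < 1/2`: instance of gen-2 `stub_isoLowerShear` (small `c`: of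
  gen-5 stubs) · `1/2 ≤ c ≤ C_floor`: `S` modulo gen-2 `IsotropicTangency` · `c > C_floor` ⟹ `S`.
-/

end Summit.CriticalPhenomena.PercolationContinuityZ3.Cruxes.SupercritExchangeUniformity.FwdRungG8
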